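import Mathlib.Computability.TuringMachine.Computable
import Mathlib.Data.Set.BoolIndicator
import Mathlib.Algebra.Polynomial.Eval.Defs
import HarnessLib

-- provenance: harness21/H21/H21/Prelude/CplxCore/TimeBounds.lean @ 8ab0aae (interim HEAD d8f2665); M5 mechanical rewrite
/-!
# Complexity core: Prop-valued time-bounded computability over Mathlib's TM2

Trunk `CplxCore`, concept C1 (`TimeBounds`): the parent of every complexity class in the H21
library.

Mathlib (`Mathlib/Computability/TuringMachine/Computable.lean`) provides the *Type-valued*
bundled notions `Turing.TM2ComputableAux Γ₀ Γ₁` (a `FinTM2` with input/output alphabets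
identified with `Γ₀`, `Γ₁`), `Turing.TM2OutputsInTime`, `Turing.TM2ComputableInTime ea eb f`
(machine + time function `ℕ → ℕ` of the input length) and
`Turing.TM2ComputableInPolyTime ea eb f` (machine + polynomial time function), together with
`Turing.idComputableInPolyTime` and the open `proof_wanted TM2ComputableInPolyTime.comp`.
We do **not** redefine any machine model. This file wraps these structures once into
*Prop-valued* predicates (via `Nonempty`), from which all classes (`P`, `NP`, `DTIME`, …) are
built downstream:

* `Turing.TM2ComputableAux.OutputsWithin M l l' m` — `M` started on input word `l` reaches the
  halting configuration with output word `l'` within `m` steps (a deliberate dot-notation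
  extension in Mathlib's `Turing` namespace);
* `ComputesInTime ea eb f T M` — per-*input* time bound `T : α → ℕ` (needed for fine-grained,
  SETH-style statements);
* `TimeComputable ea eb f t` — some machine computes `f` in time `t (ea a).length`;
* `PolyTimeComputable ea eb f` — some polynomial time bound; equivalent to
  `Nonempty (TM2ComputableInPolyTime ea eb f)` (`polyTimeComputable_iff_nonempty`);
* `DecidesInTime`, `TimeDecidable`, `PolyTimeDecidable` — the same for the Boolean indicator of a
  set, output encoded by `Computability.encodeBool`.

## Design notes

* Universes: `α β Γ₀ Γ₁ : Type`, because Mathlib's TM2 computability API is `Type`-monomorphic.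
* Halting rule. `TM2OutputsInTime tm l l' m` asks the machine to reach *exactly*
  `Turing.haltList tm l'` (all stacks except the output stack empty, internal variable reset to
  `initialState`, no label). Since one TM2 step pops `O(1)` symbols from the input stack, any
  time bound `m` with `OutputsWithin l l' m` must dominate `l.length` up to machine-dependent
  constants. Consequently every per-input bound used in the library must dominate the length of
  the whole machine input; sublinear time classes are empty in this model (harmless for all
  target statements).
* Composition of (poly-)time computable functions is only a `proof_wanted` in Mathlib; we state
  `PolyTimeComputable.comp` / `TimeComputable.comp` as `sorry`d theorems (known results:
  Arora–Barak, *Computational Complexity: A Modern Approach* (2009), Claim 1.6 / §1.3).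
* `exists_computesInTime_iff` is the definitional bridge to `Literature.Computability.FineGrained.ComputesInTime`
  (file `H21/Statements/FineGrained/Wave0.lean`), whose body is verbatim the right-hand side;
  this prelude file deliberately does not import that statements file.

## References

* S. Arora, B. Barak, *Computational Complexity: A Modern Approach*, CUP 2009, §1.2–1.3, §1.6.
* M. Sipser, *Introduction to the Theory of Computation*, 3rd ed., Def. 7.7 (TIME), Def. 7.12 (P).
-/

namespace Turing.TM2ComputableAux

open StateTransition

variable {Γ₀ Γ₁ : Type}

/-- `M.OutputsWithin l l' m`: the bundled TM2 machine `M`, started in the initial configuration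
on the input word `l : List Γ₀` (transported along `M.inputAlphabet`), reaches the halting
configuration `Turing.haltList` with output word `l' : List Γ₁` (transported along
`M.outputAlphabet`) in at most `m` steps. This is `Nonempty` of Mathlib's Type-valued
`Turing.TM2OutputsInTime`.

Halting rule: `TM2OutputsInTime` targets `haltList` (input stack empty, `var = initialState`),
and a TM2 step pops boundedly many symbols, so `OutputsWithin l l' m` forces `m ≳ l.length`
(up to constants depending on `M`). [Arora–Barak 2009, §1.2; Mathlib `Turing.TM2OutputsInTime`]

This is a deliberate dot-notation extension of Mathlib's `Turing.TM2ComputableAux`. [cite: AroraBarak2009, §1.2] -/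
def OutputsWithin (M : TM2ComputableAux Γ₀ Γ₁) (l : List Γ₀) (l' : List Γ₁) (m : ℕ) : Prop :=
  Nonempty (TM2OutputsInTime M.tm (l.map M.inputAlphabet.symm)
    (some (l'.map M.outputAlphabet.symm)) m)

/-- Monotonicity of `OutputsWithin` in the time bound: halting within `m` steps implies halting
within `m'` steps for `m ≤ m'`. [Mathlib `StateTransition.EvalsToInTime.steps_le_m`] [folklore] -/
theorem OutputsWithin.mono {M : TM2ComputableAux Γ₀ Γ₁} {l : List Γ₀} {l' : List Γ₁}
    {m m' : ℕ} (h : M.OutputsWithin l l' m) (hm : m ≤ m') : M.OutputsWithin l l' m' := by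
  obtain ⟨e⟩ := h
  exact ⟨⟨e.toEvalsTo, e.steps_le_m.trans hm⟩⟩

end Turing.TM2ComputableAux

namespace Literature.Computability.Complexity

open Turing _root_.Computability StateTransition

variable {α β γ Γ₀ Γ₁ Γ₂ : Type}

/-- `ComputesInTime ea eb f T M`: the machine `M` computes `f : α → β` with respect to the
encoders `ea`, `eb`, halting on every input `a` with output `eb (f a)` within `T a` steps.
The bound `T : α → ℕ` is per *input* (not per input length), as needed for fine-grained
statements; cf. `TimeComputable` for the length-indexed version.
[Arora–Barak 2009, §1.2 "computing a function and running time"] [cite: AroraBarak2009, §1.2 "computing a function and running t] -/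
def ComputesInTime (ea : α → List Γ₀) (eb : β → List Γ₁) (f : α → β) (T : α → ℕ)
    (M : TM2ComputableAux Γ₀ Γ₁) : Prop :=
  ∀ a, M.OutputsWithin (ea a) (eb (f a)) (T a)

/-- Monotonicity of `ComputesInTime` in the per-input time bound. [Arora–Barak 2009, §1.2] [cite: AroraBarak2009, §1.2] -/
theorem ComputesInTime.mono {ea : α → List Γ₀} {eb : β → List Γ₁} {f : α → β} {T T' : α → ℕ}
    {M : TM2ComputableAux Γ₀ Γ₁} (h : ComputesInTime ea eb f T M) (hT : ∀ a, T a ≤ T' a) :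
    ComputesInTime ea eb f T' M :=
  fun a => (h a).mono (hT a)

/-- `TimeComputable ea eb f t`: some TM2 machine computes `f` within `t n` steps on every input
whose encoding has length `n`. Prop-valued version of Mathlib's `Turing.TM2ComputableInTime`
with a prescribed time function (see `timeComputable_iff_exists_TM2ComputableInTime`).
[Arora–Barak 2009, §1.2; Sipser, Def. 7.7] [cite: AroraBarak2009, §1.2] -/
def TimeComputable (ea : α → List Γ₀) (eb : β → List Γ₁) (f : α → β) (t : ℕ → ℕ) : Prop :=
  ∃ M : TM2ComputableAux Γ₀ Γ₁, ComputesInTime ea eb f (fun a => t (ea a).length) M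

/-- Monotonicity of `TimeComputable` in the time function. [Arora–Barak 2009, §1.2] [cite: AroraBarak2009, §1.2] -/
theorem TimeComputable.mono {ea : α → List Γ₀} {eb : β → List Γ₁} {f : α → β} {t t' : ℕ → ℕ}
    (h : TimeComputable ea eb f t) (ht : ∀ n, t n ≤ t' n) : TimeComputable ea eb f t' := by
  obtain ⟨M, hM⟩ := h
  exact ⟨M, hM.mono fun a => ht _⟩

/-- `PolyTimeComputable ea eb f`: `f` is computable by some TM2 machine within `p n` steps on
inputs of encoded length `n`, for some polynomial `p : Polynomial ℕ`. Equivalent to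
`Nonempty (Turing.TM2ComputableInPolyTime ea eb f)` (`polyTimeComputable_iff_nonempty`).
[Arora–Barak 2009, Def. 1.12–1.13 (FP, P); Sipser, Def. 7.12] [cite: AroraBarak2009, Def. 1.12–1.13 (FP  P] -/
def PolyTimeComputable (ea : α → List Γ₀) (eb : β → List Γ₁) (f : α → β) : Prop :=
  ∃ p : Polynomial ℕ, TimeComputable ea eb f (fun n => p.eval n)

/-- `PolyTimeComputable` is exactly nonemptiness of Mathlib's bundled
`Turing.TM2ComputableInPolyTime`. [Mathlib `Turing.TM2ComputableInPolyTime`] [folklore] -/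
theorem polyTimeComputable_iff_nonempty {ea : α → List Γ₀} {eb : β → List Γ₁} {f : α → β} :
    PolyTimeComputable ea eb f ↔ Nonempty (TM2ComputableInPolyTime ea eb f) := by
  constructor
  · rintro ⟨p, M, hM⟩
    exact ⟨⟨M, p, fun a => Classical.choice (hM a)⟩⟩
  · rintro ⟨⟨M, p, h⟩⟩
    exact ⟨p, M, fun a => ⟨h a⟩⟩

/-- `TimeComputable ea eb f t` holds iff there is a bundled `Turing.TM2ComputableInTime ea eb f`
whose time function is pointwise at most `t`. [Mathlib `Turing.TM2ComputableInTime`] [folklore] -/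
theorem timeComputable_iff_exists_TM2ComputableInTime {ea : α → List Γ₀} {eb : β → List Γ₁}
    {f : α → β} {t : ℕ → ℕ} :
    TimeComputable ea eb f t ↔
      ∃ M : TM2ComputableInTime ea eb f, ∀ n, M.time n ≤ t n := by
  constructor
  · rintro ⟨M, hM⟩
    exact ⟨⟨M, t, fun a => Classical.choice (hM a)⟩, fun _ => le_rfl⟩
  · rintro ⟨⟨M, t', h⟩, ht⟩
    exact ⟨M, fun a => TM2ComputableAux.OutputsWithin.mono ⟨h a⟩ (ht _)⟩

/-- A function computable within a polynomial time bound is `PolyTimeComputable`.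
[Arora–Barak 2009, §1.2] [cite: AroraBarak2009, §1.2] -/
theorem PolyTimeComputable.of_timeComputable {ea : α → List Γ₀} {eb : β → List Γ₁} {f : α → β}
    (p : Polynomial ℕ) (h : TimeComputable ea eb f fun n => p.eval n) :
    PolyTimeComputable ea eb f :=
  ⟨p, h⟩

/-- The identity is polynomial-time computable with respect to any encoder over a finite
alphabet (via Mathlib's `Turing.idComputableInPolyTime`). [Mathlib; Arora–Barak 2009, §1.2] [cite: AroraBarak2009, §1.2] -/
protected theorem PolyTimeComputable.id [Fintype Γ₀] (ea : α → List Γ₀) :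
    PolyTimeComputable ea ea id :=
  polyTimeComputable_iff_nonempty.2 ⟨idComputableInPolyTime ea⟩

/-- Composition of polynomial-time computable functions is polynomial-time computable.
This is Mathlib's open `proof_wanted Turing.TM2ComputableInPolyTime.comp` (run the first
machine, copy its output stack to the second machine's input stack, run the second machine;
the intermediate output has polynomial length). [Arora–Barak 2009, Claim 1.6 and §1.3] [cite: AroraBarak2009, Claim 1.6 and §1.3] -/
def PolyTimeComputable.comp : Prop :=
  ∀ {ea : α → List Γ₀} {eb : β → List Γ₁} {ec : γ → List Γ₂} {f : α → β} {g : β → γ} (hg : PolyTimeComputable eb ec g) (hf : PolyTimeComputable ea eb f),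
    PolyTimeComputable ea ec (g ∘ f)

/-- Composition of time-computable functions: if `f` is computable in time `t₁`, `g` in time
`t₂` with `t₂` monotone, and the encoded outputs of `f` have length at most `s n` on inputs of
length `n`, then `g ∘ f` is computable in time `c * (t₁ n + t₂ (s n) + s n) + c` for some
constant `c` (run, copy, run). Known simulation result, not in Mathlib.
[Arora–Barak 2009, §1.3 (machine composition); cf. `proof_wanted TM2ComputableInPolyTime.comp`] [cite: AroraBarak2009, §1.3 (machine composition] -/
def TimeComputable.comp : Prop :=
  ∀ {ea : α → List Γ₀} {eb : β → List Γ₁} {ec : γ → List Γ₂} {f : α → β} {g : β → γ} {t₁ t₂ s : ℕ → ℕ} (hg : TimeComputable eb ec g t₂) (hf : TimeComputable ea eb f t₁) (ht₂ : Monotone t₂) (hs : ∀ a, (eb (f a)).length ≤ s (ea a).length),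
    ∃ c : ℕ, TimeComputable ea ec (g ∘ f) fun n => c * (t₁ n + t₂ (s n) + s n) + c

/-- `DecidesInTime ea L T M`: the machine `M` (output alphabet `Bool`) decides membership in
`L ⊆ α` within `T a` steps on input `a`, i.e. it computes the Boolean indicator
`L.boolIndicator`, the answer being encoded by `Computability.encodeBool`.
Noncomputable because `Set.boolIndicator` is. [Arora–Barak 2009, Def. 1.13; Sipser, Def. 7.7] [cite: AroraBarak2009, Def. 1.13] -/
noncomputable def DecidesInTime (ea : α → List Γ₀) (L : Set α) (T : α → ℕ)
    (M : TM2ComputableAux Γ₀ Bool) : Prop :=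
  ComputesInTime ea encodeBool L.boolIndicator T M

/-- `TimeDecidable ea L t`: some machine decides `L` within `t n` steps on inputs of encoded
length `n`; i.e. `TimeComputable ea encodeBool L.boolIndicator t`.
[Arora–Barak 2009, Def. 1.13 (DTIME without the big-O); Sipser, Def. 7.7] [cite: AroraBarak2009, Def. 1.13 (DTIME without the big-O] -/
noncomputable def TimeDecidable (ea : α → List Γ₀) (L : Set α) (t : ℕ → ℕ) : Prop :=
  ∃ M : TM2ComputableAux Γ₀ Bool, DecidesInTime ea L (fun a => t (ea a).length) M

/-- `PolyTimeDecidable ea L`: `L` is decidable in polynomial time with respect to the encoder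
`ea`; i.e. `PolyTimeComputable ea encodeBool L.boolIndicator`.
[Arora–Barak 2009, Def. 1.13 (the class P); Sipser, Def. 7.12] [cite: AroraBarak2009, Def. 1.13 (the class P] -/
noncomputable def PolyTimeDecidable (ea : α → List Γ₀) (L : Set α) : Prop :=
  ∃ p : Polynomial ℕ, TimeDecidable ea L (fun n => p.eval n)

/-- `TimeDecidable` unfolds to `TimeComputable` of the Boolean indicator (definitional). [folklore] -/
theorem timeDecidable_iff {ea : α → List Γ₀} {L : Set α} {t : ℕ → ℕ} :
    TimeDecidable ea L t ↔ TimeComputable ea encodeBool L.boolIndicator t :=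
  Iff.rfl

/-- `PolyTimeDecidable` unfolds to `PolyTimeComputable` of the Boolean indicator
(definitional). [Arora–Barak 2009, Def. 1.13] [cite: AroraBarak2009, Def. 1.13] -/
theorem polyTimeDecidable_iff {ea : α → List Γ₀} {L : Set α} :
    PolyTimeDecidable ea L ↔ PolyTimeComputable ea encodeBool L.boolIndicator :=
  Iff.rfl

/-- Polynomial-time decidable sets are closed under complement (swap the output bit).
[Arora–Barak 2009, §2.6.1 (P = coP); Sipser, Ch. 7] [cite: AroraBarak2009, §2.6.1 (P = coP] -/
def PolyTimeDecidable.compl : Prop :=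
  ∀ {ea : α → List Γ₀} {L : Set α} (h : PolyTimeDecidable ea L),
    PolyTimeDecidable ea Lᶜ

/-- Bridge to the fine-grained trunk: existence of a machine satisfying `ComputesInTime` is,
*by definition*, the body of `Literature.FineGrained.ComputesInTime ea eb f T`
(`H21/Statements/FineGrained/Wave0.lean`), which reads verbatim as the right-hand side below.
The proof is `Iff.rfl`; this file does not import the statements file. [H21 design D8] [folklore] -/
theorem exists_computesInTime_iff {ea : α → List Γ₀} {eb : β → List Γ₁} {f : α → β}
    {T : α → ℕ} :
    (∃ M, ComputesInTime ea eb f T M) ↔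
      ∃ M : TM2ComputableAux Γ₀ Γ₁, ∀ a,
        Nonempty (TM2OutputsInTime M.tm (List.map M.inputAlphabet.symm (ea a))
          (some (List.map M.outputAlphabet.symm (eb (f a)))) (T a)) :=
  Iff.rfl

end Literature.Computability.Complexity
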